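import Summits.AtomisticToContinuum.FouriersLaw.Theses.BondHeatUncertainty

/-!
# Route `BondHeatUncertainty`: the transfer glue `TransferToNonBallistic` (item stmt-AtomisticToContinuum-9656)

`TransferToNonBallistic := LightConeBondHeat → ExtensiveSnapshotIrreversibility → LinearResponseFTUR → NessUnique →
NonBallistic`, proved as stated (pure real arithmetic over the route's own hypotheses).

Proof.  Fix the parameters, the uniqueness hypothesis, a steady-state family `μ`, `T > 0`, response coefficients
`D`, `ε > 0` and `N₀`.  `LightConeBondHeat` gives `A`, `a > 0`, `N₁` and for `N ≥ N₁` a bond `b` with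
`V_N(b,t) ≤ A √t` on `1 ≤ t ≤ aN`; `ExtensiveSnapshotIrreversibility` gives `C` with `KL ≤ C N δ²` eventually, hence
`KL ≤ max(C,0) N δ²` eventually, so `K := max(C,0) N ≥ 0` is admissible in `LinearResponseFTUR`, which at `N ≥ 2` gives
`G := D_N/(N-1) ≥ 0` and `2 G² t² ≤ V_N(b,t) (G t/T² + K)`.  At `t = aN` (`≥ 1` once `N ≥ 1/a`), writing `N = r²`,
`a = s²`, `A' = max(A,0)`, `C' = max(C,0)`: `2 G² s⁴ r ≤ A' s (G s²/T² + C')`; if `G > ε` this forces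
`r ≤ R := (A' s³/T² + A' s C'/ε)/(2 a² ε)`, so at any `N > R²` (and `≥ N₀, N₁, 2, 1/a`) we get `G ≤ ε`, i.e.
`D_N ≤ ε (N-1)`.  (In fact `G_N = O(N^{-1/4})`.)

The arithmetic is isolated in `conductance_small_of_lightCone` (abstract `V`, `D`); the route-typed theorem
`transferToNonBallistic_proof` only instantiates it.  `NessUnique` is not needed by the argument (the uniqueness
hypothesis of `NonBallistic` is passed on to (K) and (★) directly).
-/

noncomputable section

open MeasureTheory Filter Topology Set

namespace Summit.AtomisticToContinuum.FouriersLaw.Theorems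

open Summit.AtomisticToContinuum.FouriersLaw.Theses.BondHeatUncertainty

/-- Abstract real arithmetic of the light-cone transfer.  If `V N b t ≤ A √t` on the window `1 ≤ t ≤ aN` for some
bond `b` of every long chain, and the fluctuation-theorem uncertainty relation
`2 G² t² ≤ V N b t · (G t/T² + max(C,0)·N)` holds with `G = D N/(N-1) ≥ 0` for `N ≥ 2`, every bond and every
`t > 0`, then beyond every `N₀` there is a chain with `D N ≤ ε (N - 1)`. [folklore] -/
theorem conductance_small_of_lightCone
    {V : ℕ → ℕ → ℝ → ℝ} {D : ℕ → ℝ} {A a T C ε : ℝ} {N₀ N₁ : ℕ}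
    (ha : 0 < a) (hT : 0 < T) (hε : 0 < ε)
    (hV : ∀ N : ℕ, N₁ ≤ N → ∃ b : ℕ, b + 1 < N ∧
      ∀ t : ℝ, 1 ≤ t → t ≤ a * (N : ℝ) → V N b t ≤ A * Real.sqrt t)
    (hF : ∀ N : ℕ, 2 ≤ N → 0 ≤ D N ∧ ∀ b : ℕ, b + 1 < N → ∀ t : ℝ, 0 < t →
      2 * (D N / ((N : ℝ) - 1)) ^ 2 * t ^ 2 ≤
        V N b t * (D N / ((N : ℝ) - 1) * t / T ^ 2 + max C 0 * (N : ℝ))) :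
    ∃ N : ℕ, N₀ ≤ N ∧ D N ≤ ε * ((N : ℝ) - 1) := by
  -- constants
  set A' : ℝ := max A 0 with hA'
  set C' : ℝ := max C 0 with hC'
  set s : ℝ := Real.sqrt a with hs
  have hA'0 : 0 ≤ A' := le_max_right _ _
  have hC'0 : 0 ≤ C' := le_max_right _ _
  have hs0 : 0 < s := Real.sqrt_pos.2 ha
  have hs2 : s ^ 2 = a := Real.sq_sqrt ha.le
  -- the threshold radius
  set R : ℝ := (A' * s ^ 3 / T ^ 2 + A' * s * C' / ε) / (2 * a ^ 2 * ε) with hR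
  have hR0 : 0 ≤ R := by positivity
  -- choose N
  obtain ⟨M₁, hM₁⟩ := exists_nat_ge a⁻¹
  obtain ⟨M₂, hM₂⟩ := exists_nat_gt (R ^ 2)
  set N : ℕ := max (max N₀ N₁) (max 2 (max M₁ M₂)) with hN
  have hNN₀ : N₀ ≤ N := le_trans (le_max_left _ _) (le_max_left _ _)
  have hNN₁ : N₁ ≤ N := le_trans (le_max_right _ _) (le_max_left _ _)
  have hN2 : 2 ≤ N := le_trans (le_max_left _ _) (le_max_right _ _)
  have hNM₁ : M₁ ≤ N := le_trans (le_max_left _ _) (le_trans (le_max_right _ _) (le_max_right _ _))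
  have hNM₂ : M₂ ≤ N := le_trans (le_max_right _ _) (le_trans (le_max_right _ _) (le_max_right _ _))
  refine ⟨N, hNN₀, ?_⟩
  have hN2r : (2 : ℝ) ≤ (N : ℝ) := by exact_mod_cast hN2
  have hNpos : (0 : ℝ) < N := by linarith
  have hNm1 : (0 : ℝ) < (N : ℝ) - 1 := by linarith
  have hainv : a⁻¹ ≤ (N : ℝ) := hM₁.trans (by exact_mod_cast hNM₁)
  have hR2N : R ^ 2 < (N : ℝ) := hM₂.trans_le (by exact_mod_cast hNM₂)
  -- r = √N
  set r : ℝ := Real.sqrt N with hr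
  have hr2 : r ^ 2 = (N : ℝ) := Real.sq_sqrt hNpos.le
  have hr0 : 0 < r := Real.sqrt_pos.2 hNpos
  have hRr : R < r := (Real.lt_sqrt hR0).2 hR2N
  -- the data at N
  obtain ⟨hD0, hFN⟩ := hF N hN2
  obtain ⟨b, hb, hVb⟩ := hV N hNN₁
  set t : ℝ := a * (N : ℝ) with ht
  have ht0 : 0 < t := mul_pos ha hNpos
  have ht1 : 1 ≤ t := by
    have : a * a⁻¹ ≤ a * (N : ℝ) := mul_le_mul_of_nonneg_left hainv ha.le
    rwa [mul_inv_cancel₀ ha.ne'] at this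
  have hsqt : Real.sqrt t = s * r := by rw [ht, Real.sqrt_mul ha.le]
  set G : ℝ := D N / ((N : ℝ) - 1) with hG
  have hG0 : 0 ≤ G := div_nonneg hD0 hNm1.le
  -- it suffices that the conductance is at most ε
  suffices hGε : G ≤ ε by
    rw [hG] at hGε
    exact (div_le_iff₀ hNm1).1 hGε
  by_contra hcon
  push Not at hcon
  have hGpos : 0 < G := hε.trans hcon
  -- (★) at t = aN with K = C' N, combined with the light-cone bound
  have h1 : 2 * G ^ 2 * t ^ 2 ≤ V N b t * (G * t / T ^ 2 + C' * (N : ℝ)) := hFN b hb t ht0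
  have hfac : 0 ≤ G * t / T ^ 2 + C' * (N : ℝ) := by positivity
  have h2 : V N b t ≤ A' * (s * r) := by
    rw [← hsqt]
    exact (hVb t ht1 le_rfl).trans (mul_le_mul_of_nonneg_right (le_max_left _ _) (Real.sqrt_nonneg _))
  have h3 : 2 * G ^ 2 * t ^ 2 ≤ A' * (s * r) * (G * t / T ^ 2 + C' * (N : ℝ)) :=
    h1.trans (mul_le_mul_of_nonneg_right h2 hfac)
  -- rewrite with t = s² r², N = r²
  have ht' : t = s ^ 2 * r ^ 2 := by rw [hs2, hr2]
  rw [ht', ← hr2] at h3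
  -- cancel r³ : 2 G² s⁴ r ≤ A' s (G s²/T² + C')
  have h4 : 2 * G ^ 2 * s ^ 4 * r ≤ A' * s * (G * s ^ 2 / T ^ 2 + C') := by
    have hr3 : 0 < r ^ 3 := by positivity
    have e1 : 2 * G ^ 2 * (s ^ 2 * r ^ 2) ^ 2 = (2 * G ^ 2 * s ^ 4 * r) * r ^ 3 := by ring
    have e2 : A' * (s * r) * (G * (s ^ 2 * r ^ 2) / T ^ 2 + C' * r ^ 2) =
        (A' * s * (G * s ^ 2 / T ^ 2 + C')) * r ^ 3 := by ring
    rw [e1, e2] at h3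
    exact le_of_mul_le_mul_right h3 hr3
  -- use ε < G twice
  have h5 : 2 * s ^ 4 * ε * G * r ≤ 2 * G ^ 2 * s ^ 4 * r := by
    have hεG : ε * G ≤ G * G := mul_le_mul_of_nonneg_right hcon.le hG0
    have hsr : 0 ≤ 2 * s ^ 4 * r := by positivity
    have := mul_le_mul_of_nonneg_left hεG hsr
    calc 2 * s ^ 4 * ε * G * r = 2 * s ^ 4 * r * (ε * G) := by ring
      _ ≤ 2 * s ^ 4 * r * (G * G) := this
      _ = 2 * G ^ 2 * s ^ 4 * r := by ring
  have h6 : A' * s * C' ≤ A' * s * C' * (G / ε) := by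
    have h1le : 1 ≤ G / ε := (one_le_div hε).2 hcon.le
    have h0 : 0 ≤ A' * s * C' := by positivity
    exact le_mul_of_one_le_right h0 h1le
  have h7 : 2 * s ^ 4 * ε * G * r ≤ G * (A' * s ^ 3 / T ^ 2 + A' * s * C' / ε) := by
    calc 2 * s ^ 4 * ε * G * r ≤ A' * s * (G * s ^ 2 / T ^ 2 + C') := h5.trans h4
      _ = A' * s * (G * s ^ 2 / T ^ 2) + A' * s * C' := by ring
      _ ≤ A' * s * (G * s ^ 2 / T ^ 2) + A' * s * C' * (G / ε) := by linarith
      _ = G * (A' * s ^ 3 / T ^ 2 + A' * s * C' / ε) := by ring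
  -- divide by G > 0
  have h8 : 2 * s ^ 4 * ε * r ≤ A' * s ^ 3 / T ^ 2 + A' * s * C' / ε := by
    have h7' : (2 * s ^ 4 * ε * r) * G ≤ (A' * s ^ 3 / T ^ 2 + A' * s * C' / ε) * G := by
      calc (2 * s ^ 4 * ε * r) * G = 2 * s ^ 4 * ε * G * r := by ring
        _ ≤ G * (A' * s ^ 3 / T ^ 2 + A' * s * C' / ε) := h7
        _ = (A' * s ^ 3 / T ^ 2 + A' * s * C' / ε) * G := by ring
    exact le_of_mul_le_mul_right h7' hGpos
  -- hence r ≤ R, contradicting R < r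
  have h9 : r ≤ R := by
    rw [hR, le_div_iff₀ (by positivity)]
    calc r * (2 * a ^ 2 * ε) = 2 * s ^ 4 * ε * r := by rw [← hs2]; ring
      _ ≤ _ := h8
  linarith

/-- **Item stmt-AtomisticToContinuum-9656** (`TransferToNonBallistic`, route `BondHeatUncertainty`), as stated:
light-cone bond-heat bound (S_lc) + extensive snapshot irreversibility (K) + the linear-response FTUR (★) (+ weak-NESS
uniqueness, unused) give `NonBallistic`: for every `ε > 0` there are arbitrarily long chains with `D_N ≤ ε (N-1)`.
Evaluate (★) at `t = aN` with `K = max(C,0)·N` and apply `conductance_small_of_lightCone`. -/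
theorem transferToNonBallistic_proof : TransferToNonBallistic := by
  intro hLC hK hF _hU ω₂ lam β γ hω hl hβ hγ huniq μ hμ T hT D hD ε hε N₀
  -- light-cone bond-heat bound
  have hLC' := hLC ω₂ lam β γ hω hl hβ hγ T hT
  simp only [] at hLC'
  obtain ⟨A, a, ha, N₁, hN₁⟩ := hLC'
  -- snapshot irreversibility constant
  obtain ⟨C, hC⟩ := hK ω₂ lam β γ hω hl hβ hγ huniq μ hμ T hT
  -- the fluctuation-theorem uncertainty relation
  have hF' := hF ω₂ lam β γ hω hl hβ hγ huniq μ hμ T hT D hD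
  simp only [] at hF'
  refine conductance_small_of_lightCone (C := C) ha hT hε hN₁ (fun N hN => ?_)
  obtain ⟨hD0, hb⟩ := hF' N hN
  refine ⟨hD0, fun b hb' t ht => hb b hb' t ht (max C 0 * (N : ℝ)) (by positivity) ?_⟩
  filter_upwards [hC N] with δ hδ
  refine hδ.trans (ENNReal.ofReal_le_ofReal ?_)
  have hδ2 : 0 ≤ (N : ℝ) * δ ^ 2 := by positivity
  nlinarith [le_max_left C 0, hδ2]

end Summit.AtomisticToContinuum.FouriersLaw.Theorems

end
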